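import Literature.Analysis.Calculus.MixedPartialSupBound
import Mathlib.Analysis.InnerProductSpace.PiL2
import Mathlib.MeasureTheory.Measure.Haar.InnerProductSpace
import Mathlib.Analysis.Calculus.FDeriv.Mul
import Mathlib.Analysis.Calculus.BumpFunction.FiniteDimension
import Mathlib.MeasureTheory.Integral.MeanInequalities
import Mathlib.Analysis.MeanInequalitiesPow
import HarnessLib

/-!
# The diagonal-restriction `L²` estimate for parameter-dependent functions on `ℝ³`

Topic `Literature/Analysis/Calculus`. Theorems only (no new notion).

Let `Φ(w, x)` be a function on `ℝ³ × ℝ³`, `C³` in the parameter `w`, vanishing for `|x| > D`. Then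

  `∫ |Φ(x, x)|² dx ≤ C Σ_{β ⊆ {0,1,2}} ∫_{|w| ≤ D + 1} ∫ |∂_w^β Φ(w, x)|² dx dw`

with a universal constant `C` (`exists_diag_lintegral_sq_le`; the eight mixed partials `∂_w^β` are supplied as a
family `Φt, Φv, Φu, Φvt, Φut, Φuv, Φuvt` together with the defining `fderiv` identities). Proof: for fixed `x`,
`|Φ(x, x)| = |χ(0) Φ(x, x)| ≤ ∫_w |∂₂∂₁∂₀ [χ(w − x) Φ(w, x)]| dw` by the iterated fundamental theorem of calculus
(`abs_le_integral_abs_d3`, transferred from `MixedPartialSupBound` through the volume-preserving identification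
`EuclideanSpace ℝ (Fin 3) ≃ (Fin 3 → ℝ)`), where `χ` is a fixed smooth bump (`exists_bump_with_bounds`); the
three-fold Leibniz rule (`abs_fderiv3_mul_le`) bounds the integrand by `M 𝟙_{B(x,1)}(w) Σ_β |∂_w^β Φ(w, x)|`;
Cauchy–Schwarz on the unit ball and `(Σ₈ a)² ≤ 8 Σ a²` give the pointwise bound `enorm_sq_le_of_bump`; Tonelli
and `|x| ≤ D ⇒ |w| ≤ D + 1` finish (`lintegral_lintegral_closedBall_le`).

This is the device that reduces `L²` bounds for singular integral operators with smoothly parameter-dependent kernels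
`∫ k(x − y; y) f(y) dy` (freeze the parameter at the output point `x`, `Φ(w, x) = ∫ k(x − y; w) f(y) dy`) to uniform
bounds for the frozen convolution operators — written for the mapping property (S3) of the Bogovskiĭ-type operator of
Mao–Oh–Tao (arXiv:2308.13031, Lemma 2.3) in `Literature/Geometry/Lorentzian/Bogovskii*.lean`.

## References

* [folklore] (endpoint Sobolev embedding `W^{3,1}(ℝ³) ⊂ L^∞` by the fundamental theorem of calculus, e.g.
  E. M. Stein, *Singular Integrals and Differentiability Properties of Functions* (1970), Ch. V §2).
-/

noncomputable section

open MeasureTheory Set Filter Function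
open scoped Topology

namespace Literature.Analysis.Calculus

section ThreeDerivatives

variable {E : Type*} [NormedAddCommGroup E] [NormedSpace ℝ E]

/-- Moving a fixed evaluation inside a derivative: `D_u (y ↦ DF(y) v) = (D_u DF)(·) v`. [folklore] -/
theorem fderiv_fderiv_apply_comm {F : E → ℝ} {w : E} (hF : DifferentiableAt ℝ (fderiv ℝ F) w) (u v : E) :
    fderiv ℝ (fun y ↦ fderiv ℝ F y v) w u = fderiv ℝ (fderiv ℝ F) w u v := by
  have h : HasFDerivAt (fun y ↦ fderiv ℝ F y v)
      ((ContinuousLinearMap.apply ℝ ℝ v).comp (fderiv ℝ (fderiv ℝ F) w)) w :=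
    (ContinuousLinearMap.apply ℝ ℝ v).hasFDerivAt.comp w hF.hasFDerivAt
  rw [h.fderiv]
  rfl

/-- **The third iterated derivative as three nested directional derivatives**: for `φ ∈ C³`,
`D³φ(w)[m₀, m₁, m₂] = ∂_{m₀} ∂_{m₁} ∂_{m₂} φ (w)` (outermost `m₀`, innermost `m₂`). [folklore] -/
theorem iteratedFDeriv_three_apply {φ : E → ℝ} (hφ : ContDiff ℝ 3 φ) (w : E) (m : Fin 3 → E) :
    iteratedFDeriv ℝ 3 φ w m =
      fderiv ℝ (fun y ↦ fderiv ℝ (fun z ↦ fderiv ℝ φ z (m 2)) y (m 1)) w (m 0) := by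
  rw [iteratedFDeriv_succ_apply_right]
  have h2 : ContDiff ℝ 2 (fun z ↦ fderiv ℝ φ z) := hφ.fderiv_right (m := 2) (by norm_cast)
  have heval : (fun z ↦ fderiv ℝ φ z (m 2)) = (ContinuousLinearMap.apply ℝ ℝ (m 2)) ∘ fun z ↦ fderiv ℝ φ z := by
    funext z; rfl
  have hmove : iteratedFDeriv ℝ 2 (fun z ↦ fderiv ℝ φ z) w (Fin.init m) (m (Fin.last 2)) =
      iteratedFDeriv ℝ 2 (fun z ↦ fderiv ℝ φ z (m 2)) w (Fin.init m) := by
    rw [heval, ContinuousLinearMap.iteratedFDeriv_comp_left _ h2.contDiffAt le_rfl]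
    rfl
  rw [hmove, iteratedFDeriv_two_apply]
  have hF1 : ContDiff ℝ 2 (fun z ↦ fderiv ℝ φ z (m 2)) := by
    rw [heval]; exact (ContinuousLinearMap.apply ℝ ℝ (m 2)).contDiff.comp h2
  have hdF : Differentiable ℝ (fderiv ℝ (fun z ↦ fderiv ℝ φ z (m 2))) :=
    (hF1.fderiv_right (m := 1) (by norm_cast)).differentiable (by simp)
  simp only [Fin.init_def, Fin.castSucc_zero, Fin.castSucc_one]
  rw [fderiv_fderiv_apply_comm (hdF w)]

/-- **`|φ(a)| ≤ ∫ |∂₂∂₁∂₀ φ|` on `ℝ³ = EuclideanSpace ℝ (Fin 3)`** for `φ ∈ C³_c` (transfer of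
`abs_le_integral_abs_mixedPartial` through the volume-preserving identification with `Fin 3 → ℝ`). [folklore] -/
theorem abs_le_integral_abs_d3 {φ : EuclideanSpace ℝ (Fin 3) → ℝ} (hφ : ContDiff ℝ 3 φ) (hφc : HasCompactSupport φ)
    (a : EuclideanSpace ℝ (Fin 3)) :
    |φ a| ≤ ∫ w : EuclideanSpace ℝ (Fin 3),
      |iteratedFDeriv ℝ 3 φ w (fun k ↦ EuclideanSpace.single (Fin.rev k) (1 : ℝ))| := by
  set T : (Fin 3 → ℝ) →L[ℝ] EuclideanSpace ℝ (Fin 3) :=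
    ((PiLp.continuousLinearEquiv 2 ℝ (fun _ : Fin 3 ↦ ℝ)).symm : (Fin 3 → ℝ) →L[ℝ] EuclideanSpace ℝ (Fin 3))
    with hT
  have hTapply : ∀ x, T x = WithLp.toLp 2 x := fun x ↦ rfl
  set g : (Fin 3 → ℝ) → ℝ := φ ∘ T with hg
  have hg3 : ContDiff ℝ 3 g := hφ.comp T.contDiff
  have hgc : HasCompactSupport g :=
    hφc.comp_isClosedEmbedding (PiLp.continuousLinearEquiv 2 ℝ (fun _ : Fin 3 ↦ ℝ)).symm.toHomeomorph.isClosedEmbedding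
  have h := abs_le_integral_abs_mixedPartial 3 g hg3 hgc (WithLp.ofLp a)
  have hga : g (WithLp.ofLp a) = φ a := by simp [hg, hTapply]
  rw [hga] at h
  refine h.trans (le_of_eq ?_)
  -- identify the integrands and change variables `x = ofLp w`
  have hint : ∀ x : Fin 3 → ℝ, iteratedFDeriv ℝ 3 g x (fun k ↦ Pi.single (Fin.rev k) 1) =
      iteratedFDeriv ℝ 3 φ (WithLp.toLp 2 x) (fun k ↦ EuclideanSpace.single (Fin.rev k) (1 : ℝ)) := by
    intro x
    rw [hg, ContinuousLinearMap.iteratedFDeriv_comp_right T hφ x le_rfl,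
      ContinuousMultilinearMap.compContinuousLinearMap_apply, hTapply]
    rfl
  simp_rw [hint]
  exact (PiLp.volume_preserving_toLp (Fin 3)).integral_comp (MeasurableEquiv.toLp 2 (Fin 3 → ℝ)).measurableEmbedding
    (fun w : EuclideanSpace ℝ (Fin 3) ↦ |iteratedFDeriv ℝ 3 φ w (fun k ↦ EuclideanSpace.single (Fin.rev k) (1 : ℝ))|)

end ThreeDerivatives

section Leibniz

variable {E : Type*} [NormedAddCommGroup E] [NormedSpace ℝ E]

/-- Product rule for a directional derivative of real functions. [folklore] -/
theorem fderiv_mul_apply' {f g : E → ℝ} {w : E} (hf : DifferentiableAt ℝ f w) (hg : DifferentiableAt ℝ g w) (u : E) :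
    fderiv ℝ (fun y ↦ f y * g y) w u = fderiv ℝ f w u * g w + f w * fderiv ℝ g w u := by
  rw [fderiv_fun_mul hf hg]
  simp only [FunLike.coe_add, Pi.add_apply, FunLike.coe_smul, Pi.smul_apply, smul_eq_mul]
  ring

/-- Directional derivatives of a `C^{k+1}` function are `C^k`. [folklore] -/
theorem contDiff_fderiv_apply_const {f : E → ℝ} {k : ℕ} (hf : ContDiff ℝ (k + 1) f) (v : E) :
    ContDiff ℝ k (fun y ↦ fderiv ℝ f y v) :=
  (ContinuousLinearMap.apply ℝ ℝ v).contDiff.comp (hf.fderiv_right (m := k) (by norm_cast))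

/-- **Three-fold Leibniz rule, as a bound**: for `χ, ψ ∈ C³` and directions `u, v, t`, with `M` a common bound for
`|χ|, |∂χ|, |∂²χ|, |∂³χ|` along these directions at `w`,
`|∂_u∂_v∂_t(χψ)(w)| ≤ M (|ψ| + |∂_tψ| + |∂_vψ| + |∂_uψ| + |∂_v∂_tψ| + |∂_u∂_tψ| + |∂_u∂_vψ| + |∂_u∂_v∂_tψ|)(w)`.
[folklore] -/
theorem abs_fderiv3_mul_le {χ ψ : E → ℝ} (hχ : ContDiff ℝ 3 χ) (hψ : ContDiff ℝ 3 ψ) (u v t : E) (w : E) {M : ℝ}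
    (hM0 : |χ w| ≤ M) (hMt : |fderiv ℝ χ w t| ≤ M) (hMv : |fderiv ℝ χ w v| ≤ M) (hMu : |fderiv ℝ χ w u| ≤ M)
    (hMvt : |fderiv ℝ (fun y ↦ fderiv ℝ χ y t) w v| ≤ M) (hMut : |fderiv ℝ (fun y ↦ fderiv ℝ χ y t) w u| ≤ M)
    (hMuv : |fderiv ℝ (fun y ↦ fderiv ℝ χ y v) w u| ≤ M)
    (hMuvt : |fderiv ℝ (fun y ↦ fderiv ℝ (fun z ↦ fderiv ℝ χ z t) y v) w u| ≤ M) :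
    |fderiv ℝ (fun y ↦ fderiv ℝ (fun z ↦ fderiv ℝ (fun x ↦ χ x * ψ x) z t) y v) w u| ≤
      M * (|ψ w| + |fderiv ℝ ψ w t| + |fderiv ℝ ψ w v| + |fderiv ℝ ψ w u| +
        |fderiv ℝ (fun y ↦ fderiv ℝ ψ y t) w v| + |fderiv ℝ (fun y ↦ fderiv ℝ ψ y t) w u| +
        |fderiv ℝ (fun y ↦ fderiv ℝ ψ y v) w u| +
        |fderiv ℝ (fun y ↦ fderiv ℝ (fun z ↦ fderiv ℝ ψ z t) y v) w u|) := by
  -- differentiability bookkeeping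
  have dχ : Differentiable ℝ χ := hχ.differentiable (by simp)
  have dψ : Differentiable ℝ ψ := hψ.differentiable (by simp)
  have cχt : ContDiff ℝ 2 (fun y ↦ fderiv ℝ χ y t) := contDiff_fderiv_apply_const hχ t
  have cψt : ContDiff ℝ 2 (fun y ↦ fderiv ℝ ψ y t) := contDiff_fderiv_apply_const hψ t
  have cχv : ContDiff ℝ 2 (fun y ↦ fderiv ℝ χ y v) := contDiff_fderiv_apply_const hχ v
  have cψv : ContDiff ℝ 2 (fun y ↦ fderiv ℝ ψ y v) := contDiff_fderiv_apply_const hψ v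
  have dχt : Differentiable ℝ (fun y ↦ fderiv ℝ χ y t) := cχt.differentiable (by simp)
  have dψt : Differentiable ℝ (fun y ↦ fderiv ℝ ψ y t) := cψt.differentiable (by simp)
  have dχv : Differentiable ℝ (fun y ↦ fderiv ℝ χ y v) := cχv.differentiable (by simp)
  have dψv : Differentiable ℝ (fun y ↦ fderiv ℝ ψ y v) := cψv.differentiable (by simp)
  have dχvt : Differentiable ℝ (fun y ↦ fderiv ℝ (fun z ↦ fderiv ℝ χ z t) y v) :=
    (contDiff_fderiv_apply_const cχt v).differentiable (by simp)
  have dψvt : Differentiable ℝ (fun y ↦ fderiv ℝ (fun z ↦ fderiv ℝ ψ z t) y v) :=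
    (contDiff_fderiv_apply_const cψt v).differentiable (by simp)
  -- first derivative
  have h1 : (fun z ↦ fderiv ℝ (fun x ↦ χ x * ψ x) z t) = fun z ↦ fderiv ℝ χ z t * ψ z + χ z * fderiv ℝ ψ z t := by
    funext z; exact fderiv_mul_apply' (dχ z) (dψ z) t
  -- second derivative
  have h2 : (fun y ↦ fderiv ℝ (fun z ↦ fderiv ℝ (fun x ↦ χ x * ψ x) z t) y v) = fun y ↦
      (fderiv ℝ (fun z ↦ fderiv ℝ χ z t) y v * ψ y + fderiv ℝ χ y t * fderiv ℝ ψ y v) +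
      (fderiv ℝ χ y v * fderiv ℝ ψ y t + χ y * fderiv ℝ (fun z ↦ fderiv ℝ ψ z t) y v) := by
    funext y
    have d1 : DifferentiableAt ℝ (fun z ↦ fderiv ℝ χ z t * ψ z) y := (dχt y).mul (dψ y)
    have d2 : DifferentiableAt ℝ (fun z ↦ χ z * fderiv ℝ ψ z t) y := (dχ y).mul (dψt y)
    rw [h1]
    simp only [fderiv_fun_add d1 d2, FunLike.coe_add, Pi.add_apply]
    rw [fderiv_mul_apply' (dχt y) (dψ y), fderiv_mul_apply' (dχ y) (dψt y)]
  -- third derivative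
  have dA : Differentiable ℝ (fun y ↦ fderiv ℝ (fun z ↦ fderiv ℝ χ z t) y v * ψ y) := dχvt.mul dψ
  have dB : Differentiable ℝ (fun y ↦ fderiv ℝ χ y t * fderiv ℝ ψ y v) := dχt.mul dψv
  have dC : Differentiable ℝ (fun y ↦ fderiv ℝ χ y v * fderiv ℝ ψ y t) := dχv.mul dψt
  have dD : Differentiable ℝ (fun y ↦ χ y * fderiv ℝ (fun z ↦ fderiv ℝ ψ z t) y v) := dχ.mul dψvt
  have h3 : fderiv ℝ (fun y ↦ fderiv ℝ (fun z ↦ fderiv ℝ (fun x ↦ χ x * ψ x) z t) y v) w u =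
      ((fderiv ℝ (fun y ↦ fderiv ℝ (fun z ↦ fderiv ℝ χ z t) y v) w u * ψ w +
          fderiv ℝ (fun z ↦ fderiv ℝ χ z t) w v * fderiv ℝ ψ w u) +
        (fderiv ℝ (fun y ↦ fderiv ℝ χ y t) w u * fderiv ℝ ψ w v +
          fderiv ℝ χ w t * fderiv ℝ (fun y ↦ fderiv ℝ ψ y v) w u)) +
      ((fderiv ℝ (fun y ↦ fderiv ℝ χ y v) w u * fderiv ℝ ψ w t +
          fderiv ℝ χ w v * fderiv ℝ (fun y ↦ fderiv ℝ ψ y t) w u) +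
        (fderiv ℝ χ w u * fderiv ℝ (fun z ↦ fderiv ℝ ψ z t) w v +
          χ w * fderiv ℝ (fun y ↦ fderiv ℝ (fun z ↦ fderiv ℝ ψ z t) y v) w u)) := by
    have dAB : DifferentiableAt ℝ (fun y ↦ fderiv ℝ (fun z ↦ fderiv ℝ χ z t) y v * ψ y +
        fderiv ℝ χ y t * fderiv ℝ ψ y v) w := (dA w).add (dB w)
    have dCD : DifferentiableAt ℝ (fun y ↦ fderiv ℝ χ y v * fderiv ℝ ψ y t +
        χ y * fderiv ℝ (fun z ↦ fderiv ℝ ψ z t) y v) w := (dC w).add (dD w)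
    rw [h2]
    simp only [fderiv_fun_add dAB dCD, fderiv_fun_add (dA w) (dB w), fderiv_fun_add (dC w) (dD w),
      FunLike.coe_add, Pi.add_apply]
    rw [fderiv_mul_apply' (dχvt w) (dψ w), fderiv_mul_apply' (dχt w) (dψv w),
      fderiv_mul_apply' (dχv w) (dψt w), fderiv_mul_apply' (dχ w) (dψvt w)]
  rw [h3]
  have hM : 0 ≤ M := le_trans (abs_nonneg _) hM0
  -- bound each of the eight products by `M * |ψ-term|`
  have e1 := abs_mul (fderiv ℝ (fun y ↦ fderiv ℝ (fun z ↦ fderiv ℝ χ z t) y v) w u) (ψ w)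
  have e2 := abs_mul (fderiv ℝ (fun z ↦ fderiv ℝ χ z t) w v) (fderiv ℝ ψ w u)
  have e3 := abs_mul (fderiv ℝ (fun y ↦ fderiv ℝ χ y t) w u) (fderiv ℝ ψ w v)
  have e4 := abs_mul (fderiv ℝ χ w t) (fderiv ℝ (fun y ↦ fderiv ℝ ψ y v) w u)
  have e5 := abs_mul (fderiv ℝ (fun y ↦ fderiv ℝ χ y v) w u) (fderiv ℝ ψ w t)
  have e6 := abs_mul (fderiv ℝ χ w v) (fderiv ℝ (fun y ↦ fderiv ℝ ψ y t) w u)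
  have e7 := abs_mul (fderiv ℝ χ w u) (fderiv ℝ (fun z ↦ fderiv ℝ ψ z t) w v)
  have e8 := abs_mul (χ w) (fderiv ℝ (fun y ↦ fderiv ℝ (fun z ↦ fderiv ℝ ψ z t) y v) w u)
  have b1 := mul_le_mul_of_nonneg_right hMuvt (abs_nonneg (ψ w))
  have b2 := mul_le_mul_of_nonneg_right hMvt (abs_nonneg (fderiv ℝ ψ w u))
  have b3 := mul_le_mul_of_nonneg_right hMut (abs_nonneg (fderiv ℝ ψ w v))
  have b4 := mul_le_mul_of_nonneg_right hMt (abs_nonneg (fderiv ℝ (fun y ↦ fderiv ℝ ψ y v) w u))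
  have b5 := mul_le_mul_of_nonneg_right hMuv (abs_nonneg (fderiv ℝ ψ w t))
  have b6 := mul_le_mul_of_nonneg_right hMv (abs_nonneg (fderiv ℝ (fun y ↦ fderiv ℝ ψ y t) w u))
  have b7 := mul_le_mul_of_nonneg_right hMu (abs_nonneg (fderiv ℝ (fun z ↦ fderiv ℝ ψ z t) w v))
  have b8 := mul_le_mul_of_nonneg_right hM0
    (abs_nonneg (fderiv ℝ (fun y ↦ fderiv ℝ (fun z ↦ fderiv ℝ ψ z t) y v) w u))
  calc _ ≤ (|fderiv ℝ (fun y ↦ fderiv ℝ (fun z ↦ fderiv ℝ χ z t) y v) w u * ψ w| +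
          |fderiv ℝ (fun z ↦ fderiv ℝ χ z t) w v * fderiv ℝ ψ w u|) +
        (|fderiv ℝ (fun y ↦ fderiv ℝ χ y t) w u * fderiv ℝ ψ w v| +
          |fderiv ℝ χ w t * fderiv ℝ (fun y ↦ fderiv ℝ ψ y v) w u|) +
      ((|fderiv ℝ (fun y ↦ fderiv ℝ χ y v) w u * fderiv ℝ ψ w t| +
          |fderiv ℝ χ w v * fderiv ℝ (fun y ↦ fderiv ℝ ψ y t) w u|) +
        (|fderiv ℝ χ w u * fderiv ℝ (fun z ↦ fderiv ℝ ψ z t) w v| +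
          |χ w * fderiv ℝ (fun y ↦ fderiv ℝ (fun z ↦ fderiv ℝ ψ z t) y v) w u|)) := by
        refine (abs_add_le _ _).trans (add_le_add ((abs_add_le _ _).trans (add_le_add (abs_add_le _ _)
          (abs_add_le _ _))) ((abs_add_le _ _).trans (add_le_add (abs_add_le _ _) (abs_add_le _ _))))
    _ ≤ _ := by
        rw [e1, e2, e3, e4, e5, e6, e7, e8]
        nlinarith [b1, b2, b3, b4, b5, b6, b7, b8, abs_nonneg (ψ w), abs_nonneg (fderiv ℝ ψ w t)]

end Leibniz


section Diagonal

open scoped ENNReal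
open Metric

/-- `‖r‖ₑ² = ofReal (r²)` for real `r` (real exponent `2`). [folklore] -/
theorem enorm_rpow_two_eq_ofReal_sq (r : ℝ) : ‖r‖ₑ ^ (2 : ℝ) = ENNReal.ofReal (r ^ 2) := by
  rw [Real.enorm_eq_ofReal_abs, ENNReal.ofReal_rpow_of_nonneg (abs_nonneg r) (by norm_num),
    Real.rpow_two, sq_abs]

/-- A fixed smooth bump on `ℝ³` equal to `1` at the origin and vanishing off the unit ball, together with a uniform
bound `M` on it and on its directional derivatives of order `≤ 3` along three given directions. [folklore] -/
theorem exists_bump_with_bounds (u v t : EuclideanSpace ℝ (Fin 3)) :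
    ∃ (χ : EuclideanSpace ℝ (Fin 3) → ℝ) (M : ℝ), ContDiff ℝ 3 χ ∧ χ 0 = 1 ∧
      (∀ y, 1 ≤ ‖y‖ → χ y = 0) ∧ HasCompactSupport χ ∧
      (∀ y, |χ y| ≤ M) ∧ (∀ y, |fderiv ℝ χ y t| ≤ M) ∧ (∀ y, |fderiv ℝ χ y v| ≤ M) ∧
      (∀ y, |fderiv ℝ χ y u| ≤ M) ∧ (∀ y, |fderiv ℝ (fun z ↦ fderiv ℝ χ z t) y v| ≤ M) ∧
      (∀ y, |fderiv ℝ (fun z ↦ fderiv ℝ χ z t) y u| ≤ M) ∧ (∀ y, |fderiv ℝ (fun z ↦ fderiv ℝ χ z v) y u| ≤ M) ∧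
      (∀ y, |fderiv ℝ (fun y' ↦ fderiv ℝ (fun z ↦ fderiv ℝ χ z t) y' v) y u| ≤ M) := by
  let b : ContDiffBump (0 : EuclideanSpace ℝ (Fin 3)) := ⟨1 / 2, 1, by norm_num, by norm_num⟩
  set χ : EuclideanSpace ℝ (Fin 3) → ℝ := ⇑b with hχ
  have hχ3 : ContDiff ℝ 3 χ := b.contDiff
  have hχc : HasCompactSupport χ := b.hasCompactSupport
  have hχ0 : χ 0 = 1 := b.one_of_mem_closedBall (by simp [b])
  have hχout : ∀ y, 1 ≤ ‖y‖ → χ y = 0 := fun y hy ↦ b.zero_of_le_dist (by simpa [b] using hy)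
  -- the seven derivative functions are continuous with compact support
  have c1 : ∀ a : EuclideanSpace ℝ (Fin 3), ContDiff ℝ 2 (fun y ↦ fderiv ℝ χ y a) := fun a ↦
    contDiff_fderiv_apply_const hχ3 a
  have c2 : ∀ a a' : EuclideanSpace ℝ (Fin 3), ContDiff ℝ 1 (fun y ↦ fderiv ℝ (fun z ↦ fderiv ℝ χ z a) y a') :=
    fun a a' ↦ contDiff_fderiv_apply_const (c1 a) a'
  have c3 : ∀ a a' a'' : EuclideanSpace ℝ (Fin 3),
      ContDiff ℝ 0 (fun y ↦ fderiv ℝ (fun y' ↦ fderiv ℝ (fun z ↦ fderiv ℝ χ z a) y' a') y a'') :=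
    fun a a' a'' ↦ contDiff_fderiv_apply_const (c2 a a') a''
  have s1 : ∀ a : EuclideanSpace ℝ (Fin 3), HasCompactSupport (fun y ↦ fderiv ℝ χ y a) := fun a ↦
    hχc.fderiv_apply (𝕜 := ℝ) a
  have s2 : ∀ a a' : EuclideanSpace ℝ (Fin 3), HasCompactSupport (fun y ↦ fderiv ℝ (fun z ↦ fderiv ℝ χ z a) y a') :=
    fun a a' ↦ (s1 a).fderiv_apply (𝕜 := ℝ) a'
  have s3 : ∀ a a' a'' : EuclideanSpace ℝ (Fin 3),
      HasCompactSupport (fun y ↦ fderiv ℝ (fun y' ↦ fderiv ℝ (fun z ↦ fderiv ℝ χ z a) y' a') y a'') :=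
    fun a a' a'' ↦ (s2 a a').fderiv_apply (𝕜 := ℝ) a''
  obtain ⟨M0, hM0⟩ := hχ3.continuous.bounded_above_of_compact_support hχc
  obtain ⟨Mt, hMt⟩ := (c1 t).continuous.bounded_above_of_compact_support (s1 t)
  obtain ⟨Mv, hMv⟩ := (c1 v).continuous.bounded_above_of_compact_support (s1 v)
  obtain ⟨Mu, hMu⟩ := (c1 u).continuous.bounded_above_of_compact_support (s1 u)
  obtain ⟨Mvt, hMvt⟩ := (c2 t v).continuous.bounded_above_of_compact_support (s2 t v)
  obtain ⟨Mut, hMut⟩ := (c2 t u).continuous.bounded_above_of_compact_support (s2 t u)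
  obtain ⟨Muv, hMuv⟩ := (c2 v u).continuous.bounded_above_of_compact_support (s2 v u)
  obtain ⟨Muvt, hMuvt⟩ := (c3 t v u).continuous.bounded_above_of_compact_support (s3 t v u)
  set M : ℝ := max (max (max M0 Mt) (max Mv Mu)) (max (max Mvt Mut) (max Muv Muvt)) with hM
  refine ⟨χ, M, hχ3, hχ0, hχout, hχc, fun y ↦ ?_, fun y ↦ ?_, fun y ↦ ?_, fun y ↦ ?_, fun y ↦ ?_, fun y ↦ ?_,
    fun y ↦ ?_, fun y ↦ ?_⟩ <;> rw [← Real.norm_eq_abs]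
  · exact (hM0 y).trans (by simp [hM])
  · exact (hMt y).trans (by simp [hM])
  · exact (hMv y).trans (by simp [hM])
  · exact (hMu y).trans (by simp [hM])
  · exact (hMvt y).trans (by simp [hM])
  · exact (hMut y).trans (by simp [hM])
  · exact (hMuv y).trans (by simp [hM])
  · exact (hMuvt y).trans (by simp [hM])

/-- Translating the argument commutes with directional derivatives (pointwise). [folklore] -/
theorem fderiv_comp_sub_right_apply (f : EuclideanSpace ℝ (Fin 3) → ℝ) (x w a : EuclideanSpace ℝ (Fin 3)) :
    fderiv ℝ (fun y ↦ f (y - x)) w a = fderiv ℝ f (w - x) a := by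
  simp only [sub_eq_add_neg, fderiv_comp_add_right]

/-- Translating the argument commutes with directional derivatives (function-level). [folklore] -/
theorem fderiv_comp_sub_right_fun (f : EuclideanSpace ℝ (Fin 3) → ℝ) (x a : EuclideanSpace ℝ (Fin 3)) :
    (fun w ↦ fderiv ℝ (fun y ↦ f (y - x)) w a) = fun w ↦ fderiv ℝ f (w - x) a := by
  funext w
  simp only [sub_eq_add_neg, fderiv_comp_add_right]

/-- **Pointwise diagonal bound.** Let `Ψ : ℝ³ → ℝ` be `C³` with the prescribed first/second/third partial
derivatives `Ψt, …, Ψuvt` (along `t, v, u`), all continuous. Then for every `x`,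
`‖Ψ x‖ₑ² ≤ 8 M² |B₁| · Σ_F ∫_{B(x,1)} ‖F‖ₑ²` where `χ, M` come from `exists_bump_with_bounds` — here stated with the
bump supplied as a hypothesis. [folklore] -/
theorem enorm_sq_le_of_bump {u v t : EuclideanSpace ℝ (Fin 3)} {χ : EuclideanSpace ℝ (Fin 3) → ℝ} {M : ℝ}
    (hχ3 : ContDiff ℝ 3 χ) (hχ0 : χ 0 = 1) (hχout : ∀ y, 1 ≤ ‖y‖ → χ y = 0)
    (hM0 : ∀ y, |χ y| ≤ M) (hMt : ∀ y, |fderiv ℝ χ y t| ≤ M) (hMv : ∀ y, |fderiv ℝ χ y v| ≤ M)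
    (hMu : ∀ y, |fderiv ℝ χ y u| ≤ M) (hMvt : ∀ y, |fderiv ℝ (fun z ↦ fderiv ℝ χ z t) y v| ≤ M)
    (hMut : ∀ y, |fderiv ℝ (fun z ↦ fderiv ℝ χ z t) y u| ≤ M) (hMuv : ∀ y, |fderiv ℝ (fun z ↦ fderiv ℝ χ z v) y u| ≤ M)
    (hMuvt : ∀ y, |fderiv ℝ (fun y' ↦ fderiv ℝ (fun z ↦ fderiv ℝ χ z t) y' v) y u| ≤ M)
    (hru : EuclideanSpace.single (Fin.rev (0 : Fin 3)) (1 : ℝ) = u)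
    (hrv : EuclideanSpace.single (Fin.rev (1 : Fin 3)) (1 : ℝ) = v) (hrt : EuclideanSpace.single (Fin.rev (2 : Fin 3)) (1 : ℝ) = t)
    {Ψ Ψt Ψv Ψu Ψvt Ψut Ψuv Ψuvt : EuclideanSpace ℝ (Fin 3) → ℝ} (hΨ : ContDiff ℝ 3 Ψ)
    (ht : ∀ w, fderiv ℝ Ψ w t = Ψt w) (hv : ∀ w, fderiv ℝ Ψ w v = Ψv w) (hu : ∀ w, fderiv ℝ Ψ w u = Ψu w)
    (hvt : ∀ w, fderiv ℝ Ψt w v = Ψvt w) (hut : ∀ w, fderiv ℝ Ψt w u = Ψut w) (huv : ∀ w, fderiv ℝ Ψv w u = Ψuv w)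
    (huvt : ∀ w, fderiv ℝ Ψvt w u = Ψuvt w) (x : EuclideanSpace ℝ (Fin 3)) :
    ‖Ψ x‖ₑ ^ (2 : ℝ) ≤ 8 * (ENNReal.ofReal M ^ (2 : ℝ) * volume (closedBall x 1)) *
      ((((∫⁻ w in closedBall x 1, ‖Ψ w‖ₑ ^ (2 : ℝ)) + ∫⁻ w in closedBall x 1, ‖Ψt w‖ₑ ^ (2 : ℝ)) +
        ((∫⁻ w in closedBall x 1, ‖Ψv w‖ₑ ^ (2 : ℝ)) + ∫⁻ w in closedBall x 1, ‖Ψu w‖ₑ ^ (2 : ℝ))) +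
       (((∫⁻ w in closedBall x 1, ‖Ψvt w‖ₑ ^ (2 : ℝ)) + ∫⁻ w in closedBall x 1, ‖Ψut w‖ₑ ^ (2 : ℝ)) +
        ((∫⁻ w in closedBall x 1, ‖Ψuv w‖ₑ ^ (2 : ℝ)) + ∫⁻ w in closedBall x 1, ‖Ψuvt w‖ₑ ^ (2 : ℝ)))) := by
  -- continuity of the eight functions
  have cΨ : Continuous Ψ := hΨ.continuous
  have cΨt : Continuous Ψt := by
    rw [show Ψt = fun w ↦ fderiv ℝ Ψ w t from funext fun w ↦ (ht w).symm]
    exact (contDiff_fderiv_apply_const hΨ t).continuous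
  have cΨv : Continuous Ψv := by
    rw [show Ψv = fun w ↦ fderiv ℝ Ψ w v from funext fun w ↦ (hv w).symm]
    exact (contDiff_fderiv_apply_const hΨ v).continuous
  have cΨu : Continuous Ψu := by
    rw [show Ψu = fun w ↦ fderiv ℝ Ψ w u from funext fun w ↦ (hu w).symm]
    exact (contDiff_fderiv_apply_const hΨ u).continuous
  have kΨt : ContDiff ℝ 2 Ψt := by
    rw [show Ψt = fun w ↦ fderiv ℝ Ψ w t from funext fun w ↦ (ht w).symm]
    exact contDiff_fderiv_apply_const hΨ t
  have kΨv : ContDiff ℝ 2 Ψv := by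
    rw [show Ψv = fun w ↦ fderiv ℝ Ψ w v from funext fun w ↦ (hv w).symm]
    exact contDiff_fderiv_apply_const hΨ v
  have cΨvt : Continuous Ψvt := by
    rw [show Ψvt = fun w ↦ fderiv ℝ Ψt w v from funext fun w ↦ (hvt w).symm]
    exact (contDiff_fderiv_apply_const kΨt v).continuous
  have cΨut : Continuous Ψut := by
    rw [show Ψut = fun w ↦ fderiv ℝ Ψt w u from funext fun w ↦ (hut w).symm]
    exact (contDiff_fderiv_apply_const kΨt u).continuous
  have cΨuv : Continuous Ψuv := by
    rw [show Ψuv = fun w ↦ fderiv ℝ Ψv w u from funext fun w ↦ (huv w).symm]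
    exact (contDiff_fderiv_apply_const kΨv u).continuous
  have kΨvt : ContDiff ℝ 1 Ψvt := by
    rw [show Ψvt = fun w ↦ fderiv ℝ Ψt w v from funext fun w ↦ (hvt w).symm]
    exact contDiff_fderiv_apply_const kΨt v
  have cΨuvt : Continuous Ψuvt := by
    rw [show Ψuvt = fun w ↦ fderiv ℝ Ψvt w u from funext fun w ↦ (huvt w).symm]
    exact (contDiff_fderiv_apply_const kΨvt u).continuous
  -- the localized function `g = χ(· − x) Ψ`
  set χx : EuclideanSpace ℝ (Fin 3) → ℝ := fun y ↦ χ (y - x) with hχx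
  have hχx3 : ContDiff ℝ 3 χx := hχ3.comp (contDiff_id.sub contDiff_const)
  have hχxc : HasCompactSupport χx := by
    refine HasCompactSupport.intro (isCompact_closedBall x 1) fun y hy ↦ ?_
    apply hχout
    rw [mem_closedBall, dist_eq_norm, not_le] at hy
    exact hy.le
  set g : EuclideanSpace ℝ (Fin 3) → ℝ := fun y ↦ χx y * Ψ y with hg
  have hg3 : ContDiff ℝ 3 g := hχx3.mul hΨ
  have hgc : HasCompactSupport g := hχxc.mul_right
  have hgx : g x = Ψ x := by simp [hg, hχx, hχ0]
  -- Step 1: octant FTC and the Leibniz bound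
  set S : EuclideanSpace ℝ (Fin 3) → ℝ := fun w ↦ |Ψ w| + |Ψt w| + |Ψv w| + |Ψu w| + |Ψvt w| + |Ψut w| +
    |Ψuv w| + |Ψuvt w| with hS
  have hS0 : ∀ w, 0 ≤ S w := fun w ↦ by positivity
  have hSc : Continuous S := by
    simp only [hS]
    fun_prop
  have hbound : ∀ w, |iteratedFDeriv ℝ 3 g w (fun k ↦ EuclideanSpace.single (Fin.rev k) (1 : ℝ))| ≤
      (closedBall x 1).indicator (fun w ↦ M * S w) w := by
    intro w
    by_cases hw : w ∈ closedBall x 1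
    · rw [Set.indicator_of_mem hw, iteratedFDeriv_three_apply hg3]
      simp only [hru, hrv, hrt]
      -- bounds for the translated bump
      have b0 : |χx w| ≤ M := hM0 _
      have b1 : |fderiv ℝ χx w t| ≤ M := by rw [hχx, fderiv_comp_sub_right_apply]; exact hMt _
      have b2 : |fderiv ℝ χx w v| ≤ M := by rw [hχx, fderiv_comp_sub_right_apply]; exact hMv _
      have b3 : |fderiv ℝ χx w u| ≤ M := by rw [hχx, fderiv_comp_sub_right_apply]; exact hMu _
      have b4 : |fderiv ℝ (fun y ↦ fderiv ℝ χx y t) w v| ≤ M := by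
        rw [hχx, fderiv_comp_sub_right_fun χ x t, fderiv_comp_sub_right_apply (fun y ↦ fderiv ℝ χ y t)]
        exact hMvt _
      have b5 : |fderiv ℝ (fun y ↦ fderiv ℝ χx y t) w u| ≤ M := by
        rw [hχx, fderiv_comp_sub_right_fun χ x t, fderiv_comp_sub_right_apply (fun y ↦ fderiv ℝ χ y t)]
        exact hMut _
      have b6 : |fderiv ℝ (fun y ↦ fderiv ℝ χx y v) w u| ≤ M := by
        rw [hχx, fderiv_comp_sub_right_fun χ x v, fderiv_comp_sub_right_apply (fun y ↦ fderiv ℝ χ y v)]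
        exact hMuv _
      have b7 : |fderiv ℝ (fun y' ↦ fderiv ℝ (fun z ↦ fderiv ℝ χx z t) y' v) w u| ≤ M := by
        rw [hχx, fderiv_comp_sub_right_fun χ x t, fderiv_comp_sub_right_fun (fun y ↦ fderiv ℝ χ y t) x v,
          fderiv_comp_sub_right_apply (fun y' ↦ fderiv ℝ (fun z ↦ fderiv ℝ χ z t) y' v)]
        exact hMuvt _
      have hL := abs_fderiv3_mul_le hχx3 hΨ u v t w b0 b1 b2 b3 b4 b5 b6 b7
      refine hL.trans (le_of_eq ?_)
      simp only [hS, ht, hv, hu, hvt, hut, huv, huvt]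
    · rw [Set.indicator_of_notMem hw]
      have hw' : w ∉ tsupport g := fun h ↦ hw (by
        have : tsupport g ⊆ closedBall x 1 := by
          refine closure_minimal (fun y hy ↦ ?_) isClosed_closedBall
          by_contra hy'
          rw [mem_closedBall, dist_eq_norm, not_le] at hy'
          exact hy (by simp [hg, hχx, hχout _ hy'.le])
        exact this h)
      have h0 : iteratedFDeriv ℝ 3 g w = 0 :=
        image_eq_zero_of_notMem_tsupport fun h ↦ hw' (tsupport_iteratedFDeriv_subset (𝕜 := ℝ) (n := 3) h)
      simp [h0]
  have hSi : IntegrableOn S (closedBall x 1) := hSc.continuousOn.integrableOn_compact (isCompact_closedBall x 1)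
  have hMnn : 0 ≤ M := le_trans (abs_nonneg _) (hM0 0)
  have hreal : |Ψ x| ≤ M * ∫ w in closedBall x 1, S w := by
    calc |Ψ x| = |g x| := by rw [hgx]
      _ ≤ ∫ w, |iteratedFDeriv ℝ 3 g w (fun k ↦ EuclideanSpace.single (Fin.rev k) (1 : ℝ))| :=
          abs_le_integral_abs_d3 hg3 hgc x
      _ ≤ ∫ w, (closedBall x 1).indicator (fun w ↦ M * S w) w := by
          have hSiM : IntegrableOn (fun w ↦ M * S w) (closedBall x 1) := hSi.const_mul M
          exact integral_mono_of_nonneg (ae_of_all _ fun w ↦ abs_nonneg _)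
            (hSiM.integrable_indicator measurableSet_closedBall) (ae_of_all _ hbound)
      _ = M * ∫ w in closedBall x 1, S w := by
          rw [integral_indicator measurableSet_closedBall, integral_const_mul]
  -- Step 2: to `ℝ≥0∞`, Cauchy–Schwarz on the ball, and `(Σ₈)² ≤ 8 Σ²`
  set G : EuclideanSpace ℝ (Fin 3) → ℝ≥0∞ := fun w ↦ ((‖Ψ w‖ₑ + ‖Ψt w‖ₑ) + (‖Ψv w‖ₑ + ‖Ψu w‖ₑ)) +
    ((‖Ψvt w‖ₑ + ‖Ψut w‖ₑ) + (‖Ψuv w‖ₑ + ‖Ψuvt w‖ₑ)) with hG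
  have hGm : Measurable G := by
    simp only [hG]
    exact (((cΨ.measurable.enorm.add cΨt.measurable.enorm).add (cΨv.measurable.enorm.add cΨu.measurable.enorm)).add
      ((cΨvt.measurable.enorm.add cΨut.measurable.enorm).add (cΨuv.measurable.enorm.add cΨuvt.measurable.enorm)))
  have hSG : ∀ w, ENNReal.ofReal (S w) = G w := by
    intro w
    simp only [hS, hG]
    rw [ENNReal.ofReal_add (by positivity) (abs_nonneg _), ENNReal.ofReal_add (by positivity) (abs_nonneg _),
      ENNReal.ofReal_add (by positivity) (abs_nonneg _), ENNReal.ofReal_add (by positivity) (abs_nonneg _),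
      ENNReal.ofReal_add (by positivity) (abs_nonneg _), ENNReal.ofReal_add (by positivity) (abs_nonneg _),
      ENNReal.ofReal_add (abs_nonneg _) (abs_nonneg _)]
    simp only [← Real.enorm_eq_ofReal_abs]
    ring
  have h1 : ‖Ψ x‖ₑ ≤ ENNReal.ofReal M * ∫⁻ w in closedBall x 1, G w := by
    calc ‖Ψ x‖ₑ = ENNReal.ofReal |Ψ x| := Real.enorm_eq_ofReal_abs _
      _ ≤ ENNReal.ofReal (M * ∫ w in closedBall x 1, S w) := ENNReal.ofReal_le_ofReal hreal
      _ = ENNReal.ofReal M * ENNReal.ofReal (∫ w in closedBall x 1, S w) := ENNReal.ofReal_mul hMnn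
      _ = ENNReal.ofReal M * ∫⁻ w in closedBall x 1, G w := by
          rw [ofReal_integral_eq_lintegral_ofReal hSi (ae_of_all _ hS0)]
          simp only [hSG]
  have hCS : (∫⁻ w in closedBall x 1, G w) ^ (2 : ℝ) ≤
      volume (closedBall x 1) * ∫⁻ w in closedBall x 1, G w ^ (2 : ℝ) := by
    have h := ENNReal.lintegral_mul_le_Lp_mul_Lq (volume.restrict (closedBall x 1))
      Real.HolderConjugate.two_two hGm.aemeasurable (g := fun _ ↦ 1) aemeasurable_const
    simp only [Pi.mul_apply, mul_one, ENNReal.one_rpow, lintegral_const, Measure.restrict_apply_univ,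
      one_mul] at h
    calc (∫⁻ w in closedBall x 1, G w) ^ (2 : ℝ)
        ≤ ((∫⁻ w in closedBall x 1, G w ^ (2 : ℝ)) ^ (1 / (2 : ℝ)) * volume (closedBall x 1) ^ (1 / (2 : ℝ))) ^ (2 : ℝ) :=
          ENNReal.rpow_le_rpow h (by norm_num)
      _ = (∫⁻ w in closedBall x 1, G w ^ (2 : ℝ)) * volume (closedBall x 1) := by
          rw [ENNReal.mul_rpow_of_nonneg _ _ (by norm_num), ← ENNReal.rpow_mul, ← ENNReal.rpow_mul]
          norm_num
      _ = _ := mul_comm _ _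
  have add_rpow_two_le : ∀ a b : ℝ≥0∞, (a + b) ^ (2 : ℝ) ≤ 2 * (a ^ (2 : ℝ) + b ^ (2 : ℝ)) := by
    intro a b
    have h := ENNReal.rpow_add_le_mul_rpow_add_rpow a b (p := 2) (by norm_num)
    norm_num at h ⊢
    exact h
  have hG2 : ∀ w, G w ^ (2 : ℝ) ≤ 8 * (((‖Ψ w‖ₑ ^ (2 : ℝ) + ‖Ψt w‖ₑ ^ (2 : ℝ)) + (‖Ψv w‖ₑ ^ (2 : ℝ) + ‖Ψu w‖ₑ ^ (2 : ℝ))) +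
      ((‖Ψvt w‖ₑ ^ (2 : ℝ) + ‖Ψut w‖ₑ ^ (2 : ℝ)) + (‖Ψuv w‖ₑ ^ (2 : ℝ) + ‖Ψuvt w‖ₑ ^ (2 : ℝ)))) := by
    intro w
    simp only [hG]
    calc _ ≤ 2 * (((‖Ψ w‖ₑ + ‖Ψt w‖ₑ) + (‖Ψv w‖ₑ + ‖Ψu w‖ₑ)) ^ (2 : ℝ) +
          ((‖Ψvt w‖ₑ + ‖Ψut w‖ₑ) + (‖Ψuv w‖ₑ + ‖Ψuvt w‖ₑ)) ^ (2 : ℝ)) := add_rpow_two_le _ _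
      _ ≤ 2 * (2 * ((‖Ψ w‖ₑ + ‖Ψt w‖ₑ) ^ (2 : ℝ) + (‖Ψv w‖ₑ + ‖Ψu w‖ₑ) ^ (2 : ℝ)) +
          2 * ((‖Ψvt w‖ₑ + ‖Ψut w‖ₑ) ^ (2 : ℝ) + (‖Ψuv w‖ₑ + ‖Ψuvt w‖ₑ) ^ (2 : ℝ))) := by
          gcongr <;> exact add_rpow_two_le _ _
      _ ≤ 2 * (2 * (2 * (‖Ψ w‖ₑ ^ (2 : ℝ) + ‖Ψt w‖ₑ ^ (2 : ℝ)) + 2 * (‖Ψv w‖ₑ ^ (2 : ℝ) + ‖Ψu w‖ₑ ^ (2 : ℝ))) +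
          2 * (2 * (‖Ψvt w‖ₑ ^ (2 : ℝ) + ‖Ψut w‖ₑ ^ (2 : ℝ)) + 2 * (‖Ψuv w‖ₑ ^ (2 : ℝ) + ‖Ψuvt w‖ₑ ^ (2 : ℝ)))) := by
          gcongr <;> exact add_rpow_two_le _ _
      _ = _ := by ring
  -- measurability of the eight squared integrands and of their partial sums
  have m2 : ∀ {F : EuclideanSpace ℝ (Fin 3) → ℝ}, Continuous F → Measurable fun w ↦ ‖F w‖ₑ ^ (2 : ℝ) :=
    fun hF ↦ hF.measurable.enorm.pow_const _
  have m12 : Measurable fun w ↦ ‖Ψ w‖ₑ ^ (2 : ℝ) + ‖Ψt w‖ₑ ^ (2 : ℝ) := (m2 cΨ).add (m2 cΨt)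
  have m34 : Measurable fun w ↦ ‖Ψv w‖ₑ ^ (2 : ℝ) + ‖Ψu w‖ₑ ^ (2 : ℝ) := (m2 cΨv).add (m2 cΨu)
  have m56 : Measurable fun w ↦ ‖Ψvt w‖ₑ ^ (2 : ℝ) + ‖Ψut w‖ₑ ^ (2 : ℝ) := (m2 cΨvt).add (m2 cΨut)
  have m78 : Measurable fun w ↦ ‖Ψuv w‖ₑ ^ (2 : ℝ) + ‖Ψuvt w‖ₑ ^ (2 : ℝ) := (m2 cΨuv).add (m2 cΨuvt)
  have m1234 : Measurable fun w ↦ (‖Ψ w‖ₑ ^ (2 : ℝ) + ‖Ψt w‖ₑ ^ (2 : ℝ)) + (‖Ψv w‖ₑ ^ (2 : ℝ) + ‖Ψu w‖ₑ ^ (2 : ℝ)) :=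
    m12.add m34
  have m5678 : Measurable fun w ↦ (‖Ψvt w‖ₑ ^ (2 : ℝ) + ‖Ψut w‖ₑ ^ (2 : ℝ)) +
      (‖Ψuv w‖ₑ ^ (2 : ℝ) + ‖Ψuvt w‖ₑ ^ (2 : ℝ)) := m56.add m78
  have mall : Measurable fun w ↦ ((‖Ψ w‖ₑ ^ (2 : ℝ) + ‖Ψt w‖ₑ ^ (2 : ℝ)) + (‖Ψv w‖ₑ ^ (2 : ℝ) + ‖Ψu w‖ₑ ^ (2 : ℝ))) +
      ((‖Ψvt w‖ₑ ^ (2 : ℝ) + ‖Ψut w‖ₑ ^ (2 : ℝ)) + (‖Ψuv w‖ₑ ^ (2 : ℝ) + ‖Ψuvt w‖ₑ ^ (2 : ℝ))) := m1234.add m5678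
  have hsplit : ∫⁻ w in closedBall x 1, (((‖Ψ w‖ₑ ^ (2 : ℝ) + ‖Ψt w‖ₑ ^ (2 : ℝ)) +
      (‖Ψv w‖ₑ ^ (2 : ℝ) + ‖Ψu w‖ₑ ^ (2 : ℝ))) + ((‖Ψvt w‖ₑ ^ (2 : ℝ) + ‖Ψut w‖ₑ ^ (2 : ℝ)) +
      (‖Ψuv w‖ₑ ^ (2 : ℝ) + ‖Ψuvt w‖ₑ ^ (2 : ℝ)))) =
      (((∫⁻ w in closedBall x 1, ‖Ψ w‖ₑ ^ (2 : ℝ)) + ∫⁻ w in closedBall x 1, ‖Ψt w‖ₑ ^ (2 : ℝ)) +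
        ((∫⁻ w in closedBall x 1, ‖Ψv w‖ₑ ^ (2 : ℝ)) + ∫⁻ w in closedBall x 1, ‖Ψu w‖ₑ ^ (2 : ℝ))) +
       (((∫⁻ w in closedBall x 1, ‖Ψvt w‖ₑ ^ (2 : ℝ)) + ∫⁻ w in closedBall x 1, ‖Ψut w‖ₑ ^ (2 : ℝ)) +
        ((∫⁻ w in closedBall x 1, ‖Ψuv w‖ₑ ^ (2 : ℝ)) + ∫⁻ w in closedBall x 1, ‖Ψuvt w‖ₑ ^ (2 : ℝ))) := by
    rw [lintegral_add_left m1234, lintegral_add_left m12, lintegral_add_left m56, lintegral_add_left (m2 cΨ),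
      lintegral_add_left (m2 cΨv), lintegral_add_left (m2 cΨvt), lintegral_add_left (m2 cΨuv)]
  have hint8 : ∫⁻ w in closedBall x 1, G w ^ (2 : ℝ) ≤ 8 *
      ((((∫⁻ w in closedBall x 1, ‖Ψ w‖ₑ ^ (2 : ℝ)) + ∫⁻ w in closedBall x 1, ‖Ψt w‖ₑ ^ (2 : ℝ)) +
        ((∫⁻ w in closedBall x 1, ‖Ψv w‖ₑ ^ (2 : ℝ)) + ∫⁻ w in closedBall x 1, ‖Ψu w‖ₑ ^ (2 : ℝ))) +
       (((∫⁻ w in closedBall x 1, ‖Ψvt w‖ₑ ^ (2 : ℝ)) + ∫⁻ w in closedBall x 1, ‖Ψut w‖ₑ ^ (2 : ℝ)) +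
        ((∫⁻ w in closedBall x 1, ‖Ψuv w‖ₑ ^ (2 : ℝ)) + ∫⁻ w in closedBall x 1, ‖Ψuvt w‖ₑ ^ (2 : ℝ)))) := by
    rw [← hsplit, ← lintegral_const_mul _ mall]
    exact lintegral_mono fun w ↦ hG2 w
  -- assemble
  calc ‖Ψ x‖ₑ ^ (2 : ℝ) ≤ (ENNReal.ofReal M * ∫⁻ w in closedBall x 1, G w) ^ (2 : ℝ) := ENNReal.rpow_le_rpow h1 (by norm_num)
    _ = ENNReal.ofReal M ^ (2 : ℝ) * (∫⁻ w in closedBall x 1, G w) ^ (2 : ℝ) :=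
        ENNReal.mul_rpow_of_nonneg _ _ (by norm_num)
    _ ≤ ENNReal.ofReal M ^ (2 : ℝ) * (volume (closedBall x 1) * ∫⁻ w in closedBall x 1, G w ^ (2 : ℝ)) := by
        gcongr
    _ ≤ ENNReal.ofReal M ^ (2 : ℝ) * (volume (closedBall x 1) * (8 * _)) := by gcongr
    _ = _ := by ring

/-- Swapping the order and localizing the parameter: for measurable `F : ℝ³ × ℝ³ → ℝ` (arguments `(w, x)`) vanishing
for `|x| > D`, `∫_x ∫_{w ∈ B(x,1)} ‖F(w,x)‖ₑ² ≤ ∫_{w ∈ B̄(0,D+1)} ∫_x ‖F(w,x)‖ₑ²`. [folklore] -/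
theorem lintegral_lintegral_closedBall_le {F : EuclideanSpace ℝ (Fin 3) → EuclideanSpace ℝ (Fin 3) → ℝ}
    (hF : Measurable (uncurry F)) {D : ℝ} (hD : ∀ w x, D < ‖x‖ → F w x = 0) :
    ∫⁻ x, ∫⁻ w in closedBall x 1, ‖F w x‖ₑ ^ (2 : ℝ) ≤
      ∫⁻ w in closedBall (0 : EuclideanSpace ℝ (Fin 3)) (D + 1), ∫⁻ x, ‖F w x‖ₑ ^ (2 : ℝ) := by
  set g : EuclideanSpace ℝ (Fin 3) × EuclideanSpace ℝ (Fin 3) → ℝ≥0∞ :=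
    fun p ↦ {q : EuclideanSpace ℝ (Fin 3) × EuclideanSpace ℝ (Fin 3) | dist q.2 q.1 ≤ 1}.indicator
      (fun q ↦ ‖F q.2 q.1‖ₑ ^ (2 : ℝ)) p with hg
  have hset : MeasurableSet {q : EuclideanSpace ℝ (Fin 3) × EuclideanSpace ℝ (Fin 3) | dist q.2 q.1 ≤ 1} :=
    (isClosed_le (continuous_snd.dist continuous_fst) continuous_const).measurableSet
  have hgm : Measurable g := by
    refine Measurable.indicator ?_ hset
    exact ((hF.comp measurable_swap).enorm.pow_const _)
  have h1 : ∀ x, ∫⁻ w in closedBall x 1, ‖F w x‖ₑ ^ (2 : ℝ) = ∫⁻ w, g (x, w) := by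
    intro x
    rw [← lintegral_indicator measurableSet_closedBall]
    rfl
  simp_rw [h1]
  rw [lintegral_lintegral_swap hgm.aemeasurable]
  rw [← lintegral_indicator measurableSet_closedBall]
  refine lintegral_mono fun w ↦ ?_
  by_cases hw : w ∈ closedBall (0 : EuclideanSpace ℝ (Fin 3)) (D + 1)
  · rw [Set.indicator_of_mem hw]
    refine lintegral_mono fun x ↦ ?_
    simp only [hg]
    exact Set.indicator_le_self _ _ _
  · rw [Set.indicator_of_notMem hw]
    have h0 : ∀ x, g (x, w) = 0 := by
      intro x
      simp only [hg, Set.indicator, mem_setOf_eq]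
      split_ifs with h
      · have hx : D < ‖x‖ := by
          rw [mem_closedBall, dist_zero_right, not_le] at hw
          have : ‖w‖ ≤ ‖x‖ + dist w x := by
            calc ‖w‖ = ‖x + (w - x)‖ := by rw [add_sub_cancel]
              _ ≤ ‖x‖ + ‖w - x‖ := norm_add_le _ _
              _ = ‖x‖ + dist w x := by rw [dist_eq_norm]
          linarith
        simp [hD w x hx]
      · rfl
    simp [h0]

/-- Measurability in `x` of `x ↦ ∫_{w ∈ B(x,1)} ‖F(w,x)‖ₑ²`. [folklore] -/
theorem measurable_lintegral_closedBall {F : EuclideanSpace ℝ (Fin 3) → EuclideanSpace ℝ (Fin 3) → ℝ}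
    (hF : Measurable (uncurry F)) :
    Measurable fun x ↦ ∫⁻ w in closedBall x 1, ‖F w x‖ₑ ^ (2 : ℝ) := by
  set g : EuclideanSpace ℝ (Fin 3) × EuclideanSpace ℝ (Fin 3) → ℝ≥0∞ :=
    fun p ↦ {q : EuclideanSpace ℝ (Fin 3) × EuclideanSpace ℝ (Fin 3) | dist q.2 q.1 ≤ 1}.indicator
      (fun q ↦ ‖F q.2 q.1‖ₑ ^ (2 : ℝ)) p with hg
  have hset : MeasurableSet {q : EuclideanSpace ℝ (Fin 3) × EuclideanSpace ℝ (Fin 3) | dist q.2 q.1 ≤ 1} :=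
    (isClosed_le (continuous_snd.dist continuous_fst) continuous_const).measurableSet
  have hgm : Measurable g := Measurable.indicator ((hF.comp measurable_swap).enorm.pow_const _) hset
  have h1 : (fun x ↦ ∫⁻ w in closedBall x 1, ‖F w x‖ₑ ^ (2 : ℝ)) = fun x ↦ ∫⁻ w, g (x, w) := by
    funext x
    rw [← lintegral_indicator measurableSet_closedBall]
    rfl
  rw [h1]
  exact hgm.lintegral_prod_right'

/-- **The diagonal-restriction `L²` estimate** (dimension `3`). There is a universal constant `C < ∞` such that for
every family `Φ(w, x)` on `ℝ³ × ℝ³` which is `C³` in the parameter `w` with (jointly measurable) partial derivatives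
`Φt = ∂_{w,e₀}Φ`, `Φv = ∂_{w,e₁}Φ`, `Φu = ∂_{w,e₂}Φ`, `Φvt, Φut, Φuv, Φuvt` (mixed partials), all vanishing for `|x| > D`,

  `∫ |Φ(x, x)|² dx ≤ C Σ_{β ⊆ {0,1,2}} ∫_{|w| ≤ D+1} ∫ |∂_w^β Φ(w, x)|² dx dw`.

Proof: `|Φ(x,x)| ≤ ∫_w |∂₂∂₁∂₀[χ(w − x)Φ(w, x)]| dw` (`abs_le_integral_abs_d3`) with a fixed bump `χ`, Leibniz,
Cauchy–Schwarz on `B(x, 1)`, and Tonelli. Used to reduce `L²` bounds for singular integrals with smoothly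
parameter-dependent kernels `k(x − y, y)` to the frozen (convolution) case. [folklore] -/
theorem exists_diag_lintegral_sq_le :
    ∃ C : ℝ≥0∞, C < ⊤ ∧ ∀ (D : ℝ) (Φ Φt Φv Φu Φvt Φut Φuv Φuvt :
      EuclideanSpace ℝ (Fin 3) → EuclideanSpace ℝ (Fin 3) → ℝ),
      (∀ x, ContDiff ℝ 3 (fun w ↦ Φ w x)) →
      (∀ w x, fderiv ℝ (fun w ↦ Φ w x) w (EuclideanSpace.single 0 1) = Φt w x) →
      (∀ w x, fderiv ℝ (fun w ↦ Φ w x) w (EuclideanSpace.single 1 1) = Φv w x) →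
      (∀ w x, fderiv ℝ (fun w ↦ Φ w x) w (EuclideanSpace.single 2 1) = Φu w x) →
      (∀ w x, fderiv ℝ (fun w ↦ Φt w x) w (EuclideanSpace.single 1 1) = Φvt w x) →
      (∀ w x, fderiv ℝ (fun w ↦ Φt w x) w (EuclideanSpace.single 2 1) = Φut w x) →
      (∀ w x, fderiv ℝ (fun w ↦ Φv w x) w (EuclideanSpace.single 2 1) = Φuv w x) →
      (∀ w x, fderiv ℝ (fun w ↦ Φvt w x) w (EuclideanSpace.single 2 1) = Φuvt w x) →
      Measurable (uncurry Φ) → Measurable (uncurry Φt) → Measurable (uncurry Φv) → Measurable (uncurry Φu) →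
      Measurable (uncurry Φvt) → Measurable (uncurry Φut) → Measurable (uncurry Φuv) → Measurable (uncurry Φuvt) →
      (∀ w x, D < ‖x‖ → Φ w x = 0 ∧ Φt w x = 0 ∧ Φv w x = 0 ∧ Φu w x = 0 ∧ Φvt w x = 0 ∧ Φut w x = 0 ∧
        Φuv w x = 0 ∧ Φuvt w x = 0) →
      ∫⁻ x, ‖Φ x x‖ₑ ^ (2 : ℝ) ≤ C *
        ((((∫⁻ w in closedBall (0 : EuclideanSpace ℝ (Fin 3)) (D + 1), ∫⁻ x, ‖Φ w x‖ₑ ^ (2 : ℝ)) +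
            ∫⁻ w in closedBall (0 : EuclideanSpace ℝ (Fin 3)) (D + 1), ∫⁻ x, ‖Φt w x‖ₑ ^ (2 : ℝ)) +
          ((∫⁻ w in closedBall (0 : EuclideanSpace ℝ (Fin 3)) (D + 1), ∫⁻ x, ‖Φv w x‖ₑ ^ (2 : ℝ)) +
            ∫⁻ w in closedBall (0 : EuclideanSpace ℝ (Fin 3)) (D + 1), ∫⁻ x, ‖Φu w x‖ₑ ^ (2 : ℝ))) +
         (((∫⁻ w in closedBall (0 : EuclideanSpace ℝ (Fin 3)) (D + 1), ∫⁻ x, ‖Φvt w x‖ₑ ^ (2 : ℝ)) +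
            ∫⁻ w in closedBall (0 : EuclideanSpace ℝ (Fin 3)) (D + 1), ∫⁻ x, ‖Φut w x‖ₑ ^ (2 : ℝ)) +
          ((∫⁻ w in closedBall (0 : EuclideanSpace ℝ (Fin 3)) (D + 1), ∫⁻ x, ‖Φuv w x‖ₑ ^ (2 : ℝ)) +
            ∫⁻ w in closedBall (0 : EuclideanSpace ℝ (Fin 3)) (D + 1), ∫⁻ x, ‖Φuvt w x‖ₑ ^ (2 : ℝ)))) := by
  set u : EuclideanSpace ℝ (Fin 3) := EuclideanSpace.single 2 1 with hu_def
  set v : EuclideanSpace ℝ (Fin 3) := EuclideanSpace.single 1 1 with hv_def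
  set t : EuclideanSpace ℝ (Fin 3) := EuclideanSpace.single 0 1 with ht_def
  obtain ⟨χ, M, hχ3, hχ0, hχout, _, hM0, hMt, hMv, hMu, hMvt, hMut, hMuv, hMuvt⟩ := exists_bump_with_bounds u v t
  have hru : EuclideanSpace.single (Fin.rev (0 : Fin 3)) (1 : ℝ) = u := by rw [hu_def]; rfl
  have hrv : EuclideanSpace.single (Fin.rev (1 : Fin 3)) (1 : ℝ) = v := by rw [hv_def]; rfl
  have hrt : EuclideanSpace.single (Fin.rev (2 : Fin 3)) (1 : ℝ) = t := by rw [ht_def]; rfl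
  set V₁ : ℝ≥0∞ := volume (closedBall (0 : EuclideanSpace ℝ (Fin 3)) 1) with hV₁
  have hV₁top : V₁ < ⊤ := (isCompact_closedBall _ _).measure_lt_top
  set C : ℝ≥0∞ := 8 * (ENNReal.ofReal M ^ (2 : ℝ) * V₁) with hC
  refine ⟨C, ?_, ?_⟩
  · exact ENNReal.mul_lt_top (by norm_num) (ENNReal.mul_lt_top
      (ENNReal.rpow_lt_top_of_nonneg (by norm_num) ENNReal.ofReal_ne_top) hV₁top)
  intro D Φ Φt Φv Φu Φvt Φut Φuv Φuvt hC3 ht hv hu hvt hut huv huvt mΦ mΦt mΦv mΦu mΦvt mΦut mΦuv mΦuvt hsupp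
  -- pointwise bound at every `x`
  have hpt : ∀ x, ‖Φ x x‖ₑ ^ (2 : ℝ) ≤ C *
      ((((∫⁻ w in closedBall x 1, ‖Φ w x‖ₑ ^ (2 : ℝ)) + ∫⁻ w in closedBall x 1, ‖Φt w x‖ₑ ^ (2 : ℝ)) +
          ((∫⁻ w in closedBall x 1, ‖Φv w x‖ₑ ^ (2 : ℝ)) + ∫⁻ w in closedBall x 1, ‖Φu w x‖ₑ ^ (2 : ℝ))) +
         (((∫⁻ w in closedBall x 1, ‖Φvt w x‖ₑ ^ (2 : ℝ)) + ∫⁻ w in closedBall x 1, ‖Φut w x‖ₑ ^ (2 : ℝ)) +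
          ((∫⁻ w in closedBall x 1, ‖Φuv w x‖ₑ ^ (2 : ℝ)) + ∫⁻ w in closedBall x 1, ‖Φuvt w x‖ₑ ^ (2 : ℝ)))) := by
    intro x
    have h := enorm_sq_le_of_bump hχ3 hχ0 hχout hM0 hMt hMv hMu hMvt hMut hMuv hMuvt hru hrv hrt (hC3 x)
      (fun w ↦ ht w x) (fun w ↦ hv w x) (fun w ↦ hu w x) (fun w ↦ hvt w x) (fun w ↦ hut w x) (fun w ↦ huv w x)
      (fun w ↦ huvt w x) x
    rw [Measure.addHaar_closedBall_center volume x, ← hV₁] at h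
    exact h
  -- integrate and swap
  calc ∫⁻ x, ‖Φ x x‖ₑ ^ (2 : ℝ) ≤ ∫⁻ x, C *
      ((((∫⁻ w in closedBall x 1, ‖Φ w x‖ₑ ^ (2 : ℝ)) + ∫⁻ w in closedBall x 1, ‖Φt w x‖ₑ ^ (2 : ℝ)) +
          ((∫⁻ w in closedBall x 1, ‖Φv w x‖ₑ ^ (2 : ℝ)) + ∫⁻ w in closedBall x 1, ‖Φu w x‖ₑ ^ (2 : ℝ))) +
         (((∫⁻ w in closedBall x 1, ‖Φvt w x‖ₑ ^ (2 : ℝ)) + ∫⁻ w in closedBall x 1, ‖Φut w x‖ₑ ^ (2 : ℝ)) +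
          ((∫⁻ w in closedBall x 1, ‖Φuv w x‖ₑ ^ (2 : ℝ)) + ∫⁻ w in closedBall x 1, ‖Φuvt w x‖ₑ ^ (2 : ℝ)))) :=
        lintegral_mono hpt
    _ ≤ _ := by
        rw [lintegral_const_mul' _ _ (by
          refine ENNReal.mul_ne_top (by norm_num) (ENNReal.mul_ne_top
            (ENNReal.rpow_lt_top_of_nonneg (by norm_num) ENNReal.ofReal_ne_top).ne hV₁top.ne))]
        gcongr
        -- split the `x`-integral of the eight-term sum (measurability of each summand in `x`)
        have n1 := measurable_lintegral_closedBall mΦ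
        have n2 := measurable_lintegral_closedBall mΦt
        have n3 := measurable_lintegral_closedBall mΦv
        have n4 := measurable_lintegral_closedBall mΦu
        have n5 := measurable_lintegral_closedBall mΦvt
        have n6 := measurable_lintegral_closedBall mΦut
        have n7 := measurable_lintegral_closedBall mΦuv
        have n12 : Measurable fun x ↦ (∫⁻ w in closedBall x 1, ‖Φ w x‖ₑ ^ (2 : ℝ)) +
            ∫⁻ w in closedBall x 1, ‖Φt w x‖ₑ ^ (2 : ℝ) := n1.add n2
        have n56 : Measurable fun x ↦ (∫⁻ w in closedBall x 1, ‖Φvt w x‖ₑ ^ (2 : ℝ)) +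
            ∫⁻ w in closedBall x 1, ‖Φut w x‖ₑ ^ (2 : ℝ) := n5.add n6
        have n1234 : Measurable fun x ↦ ((∫⁻ w in closedBall x 1, ‖Φ w x‖ₑ ^ (2 : ℝ)) +
            ∫⁻ w in closedBall x 1, ‖Φt w x‖ₑ ^ (2 : ℝ)) + ((∫⁻ w in closedBall x 1, ‖Φv w x‖ₑ ^ (2 : ℝ)) +
            ∫⁻ w in closedBall x 1, ‖Φu w x‖ₑ ^ (2 : ℝ)) := n12.add (n3.add n4)
        calc _ = (((∫⁻ x, ∫⁻ w in closedBall x 1, ‖Φ w x‖ₑ ^ (2 : ℝ)) + ∫⁻ x, ∫⁻ w in closedBall x 1, ‖Φt w x‖ₑ ^ (2 : ℝ)) +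
              ((∫⁻ x, ∫⁻ w in closedBall x 1, ‖Φv w x‖ₑ ^ (2 : ℝ)) + ∫⁻ x, ∫⁻ w in closedBall x 1, ‖Φu w x‖ₑ ^ (2 : ℝ))) +
            (((∫⁻ x, ∫⁻ w in closedBall x 1, ‖Φvt w x‖ₑ ^ (2 : ℝ)) + ∫⁻ x, ∫⁻ w in closedBall x 1, ‖Φut w x‖ₑ ^ (2 : ℝ)) +
              ((∫⁻ x, ∫⁻ w in closedBall x 1, ‖Φuv w x‖ₑ ^ (2 : ℝ)) +
                ∫⁻ x, ∫⁻ w in closedBall x 1, ‖Φuvt w x‖ₑ ^ (2 : ℝ))) := by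
              rw [lintegral_add_left n1234, lintegral_add_left n12, lintegral_add_left n56, lintegral_add_left n1,
                lintegral_add_left n3, lintegral_add_left n5, lintegral_add_left n7]
          _ ≤ _ :=
              add_le_add
                (add_le_add
                  (add_le_add (lintegral_lintegral_closedBall_le mΦ fun w x hx ↦ (hsupp w x hx).1)
                    (lintegral_lintegral_closedBall_le mΦt fun w x hx ↦ (hsupp w x hx).2.1))
                  (add_le_add (lintegral_lintegral_closedBall_le mΦv fun w x hx ↦ (hsupp w x hx).2.2.1)
                    (lintegral_lintegral_closedBall_le mΦu fun w x hx ↦ (hsupp w x hx).2.2.2.1)))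
                (add_le_add
                  (add_le_add (lintegral_lintegral_closedBall_le mΦvt fun w x hx ↦ (hsupp w x hx).2.2.2.2.1)
                    (lintegral_lintegral_closedBall_le mΦut fun w x hx ↦ (hsupp w x hx).2.2.2.2.2.1))
                  (add_le_add (lintegral_lintegral_closedBall_le mΦuv fun w x hx ↦ (hsupp w x hx).2.2.2.2.2.2.1)
                    (lintegral_lintegral_closedBall_le mΦuvt fun w x hx ↦ (hsupp w x hx).2.2.2.2.2.2.2)))

end Diagonal

end Literature.Analysis.Calculus

end
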